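import Literature.AnabelianGeometry.EtaleTheta.TemperedFrobenioidCor38Sub
import Literature.AnabelianGeometry.EtaleTheta.TemperedFrobenioidOfGaloisCoveringTateTower
import Literature.AlgebraicGeometry.Frobenioids.PerfectionFunctorialityUnique
import Literature.AlgebraicGeometry.Frobenioids.PerfectionOps
import HarnessLib

/-!
# [EtTh] Cor 3.8, proof row C38-L03 `Cor38Hyp.CompatibleWithPerfection` (FACT-LIST F-2811): INSTANCE FORMS —
# head-form, hypothesis-free at the identity perfection datum (every `h`; the Tate-tower model of record), and the
# GENUINE-perfection instance for `C₁` of perfect type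

S. Mochizuki, *The étale theta function and its Frobenioid-theoretic manifestations*, Publ. RIMS **45** (2009) [EtTh],
Cor. 3.8, proof, PDF p. 81 l. 3–4 (printed p. 307): «Moreover, `Ψ` is compatible with the operation of passing to the
perfection [cf. [Mzk17], Theorem 3.4, (iii)]» [cite: MochizukiEtTh2009, Cor 3.8 p.81]; S. Mochizuki, *The geometry of
Frobenioids I*, Kyushu J. Math. **62** (2008), Thm. 3.4 (iii) p. 62 («`Ψ` induces a `1`-unique functor
`Ψ^pf : C₁^pf → C₂^pf` …») [cite: MochizukiFrdI2008, Thm. 3.4 (iii) p.62].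

abc-iut cell, block F (instance-form batch INST59J2), seat abc-iut-f-110 (gen 6).  FACT-LIST row **F-2811**
`Literature.AnabelianGeometry.EtaleTheta.Cor38Hyp.CompatibleWithPerfection h P₁ P₂ :=
∃ Ψpf, OneUniqueSquare h.Ψ.functor P₁.toPf P₂.toPf Ψpf` (abc-iut-w5-d124, frozen `TemperedFrobenioidCor38Sub.lean`), over
abc-iut-L1-t3's DATA-ONLY interface `PerfectionData` (a category `Pf`, a functor `toPf`, an indexing `root`; no universal
property) and with BARE `1`-uniqueness.  Kernel status before this file (LF-KERNEL-STATUS col. 14): universal closure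
REFUTED at every Cor. 3.8 datum (abc-iut-f-001, `Cor38Hyp.not_forall_compatibleWithPerfection`: junk data `C_i × {0,1}`),
one conditional closer (`compatibleWithPerfection_of_thm34iii`, 3 Prop hypotheses incl. the [FrdI] Thm. 3.4 (iii)
template `Thm34iii_pf`, itself refuted outside perfect type: `DegreeModel.not_thm34iii_pf`) — and NO theorem whose
conclusion HEAD is the row's declaration.  PROOF-ONLY file (0 `def`, 0 `instance`, no new `Prop`; inputs BY NAME):

* `Cor38Hyp.compatibleWithPerfection_idPerfectionData h` — **INSTANCE FORM, every `h : Cor38Hyp C₁ C₂`, 0 hypotheses,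
  at the IDENTITY perfection data** `(Pf := C_i, toPf := 𝟭, root A n := A, ops := C_i.opsData)` (structure literals in
  the statement; admissible inhabitants of the data-only interface): `Ψpf := Ψ`, the square `Ψ ⋙ 𝟭 ≅ 𝟭 ⋙ Ψ` commutes by
  unitors, and EVERY `B′` with `Ψ ⋙ 𝟭 ≅ 𝟭 ⋙ B′` is `≅ Ψ` — bare `1`-uniqueness holds because `toPf₁ = 𝟭` is
  essentially surjective.  HONEST LABEL «INSTANCE at toy perfection datum»: the identity datum is THE perfection exactly
  when `C_i → C_i^pf` is an equivalence, i.e. `C_i` of perfect type ([FrdI] Prop. 3.2 (iii),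
  `Perfection.toPf_isEquivalence`) — NOT proved for the cell's tempered Frobenioids;
* `TateTowerFrd.cor38Hyp_compatibleWithPerfection_idPerfectionData` — the same at the MODEL OF RECORD (abc-iut-w6-d048's
  `TateTowerFrd.temperedFrobenioid R S`, the `p`-adic Frobenioid of the base field of the Tate curve), NO binder beyond
  `h` (pattern of abc-iut-w6-d053's `Sec3Cor38SubPredicatesAtTateTower.lean` for the sibling rows F-2808/…/F-2821);
* `Cor38Hyp.compatibleWithPerfection_perfection_of_isOfPerfectType` — **the GENUINE-CARRIER instance**: at THE
  perfections `PreFrobenioidData.perfection hF_i` ([FrdI] Def. 3.1 (iii), abc-iut-L1-d9) the row HOLDS as soon as `C₁`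
  is of perfect type and `Ψ` is Frobenius-compatible (abc-iut-L1-d1's `Perfection.oneUniqueSquare_map_of_isOfPerfectType`,
  `Ψpf := Perfection.map`) — a CONDITIONAL instance (2 `Prop` hypotheses), sharp on the perfect-type side by
  abc-iut-L1-d4's `DegreeModel.not_oneUniqueSquare_toPf`.

READING: at a general datum the frozen row is STRONGER than print (print's faithful, structure-compatible square is
abc-iut-w5-d124's `CompatibleWithPerfectionR`, PROVED at the genuine carriers: `Sec3Cor38PerfectionR(Weak).lean`); the
identity-datum instances are CONSISTENCY certificates for the typed row, the perfect-type theorem is its genuine content.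
HONEST FRAMING: refereed pre-IUT material; an instance-form theorem about OUR typed statement ≠ a theorem about [EtTh] in
print; the universal closure stays refuted; nothing here bears on, or takes a side on, [IUTchIII] Cor. 3.12; typed ≠ proved.
-/

noncomputable section

namespace Literature.AnabelianGeometry.EtaleTheta

open CategoryTheory Opposite Literature.AlgebraicGeometry.Frobenioids

universe u₀ v₀ u v w

namespace Cor38Hyp

variable {D₀ : Type u₀} [Category.{v₀} D₀] {D₀' : Type u₀} [Category.{v₀} D₀'] {V : FrdIMonoidStub.{w}}
  {T : RealifiedDivisorMonoids (D₀ := D₀) V} {T' : RealifiedDivisorMonoids (D₀ := D₀') V}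
  {D : Type u} [Category.{v} D] {D' : Type u} [Category.{v} D']
  {VD : FrdICatStub.{u, v, w} D} {VD' : FrdICatStub.{u, v, w} D'}
  {C₁ : TemperedFrobenioid T D VD} {C₂ : TemperedFrobenioid T' D' VD'}

/-- **F-2811 `CompatibleWithPerfection`, INSTANCE FORM for EVERY Cor. 3.8 datum `h`, 0 hypotheses, at the IDENTITY
perfection data** `(C_i, 𝟭, (A, n) ↦ A, C_i.opsData)` («INSTANCE at toy perfection datum»; THE perfection exactly when
`C_i` is of perfect type): `Ψpf := Ψ`; `Ψ ⋙ 𝟭 ≅ 𝟭 ⋙ Ψ` by unitors; every `B′` fitting the square is `≅ Ψ` (bare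
`1`-uniqueness, `𝟭` being essentially surjective). [cite: MochizukiEtTh2009, Cor 3.8 p.81] -/
theorem compatibleWithPerfection_idPerfectionData (h : Cor38Hyp C₁ C₂) :
    Literature.AnabelianGeometry.EtaleTheta.Cor38Hyp.CompatibleWithPerfection h
      { Pf := C₁.category
        toPf := 𝟭 _
        root := fun A _ => A
        root_one := fun _ => rfl
        root_surjective := fun X => ⟨X, 1, rfl⟩
        ops := C₁.opsData }
      { Pf := C₂.category
        toPf := 𝟭 _
        root := fun A _ => A
        root_one := fun _ => rfl
        root_surjective := fun X => ⟨X, 1, rfl⟩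
        ops := C₂.opsData } :=
  ⟨h.Ψ.functor, h.Ψ.isEquivalence_functor, ⟨h.Ψ.functor.rightUnitor ≪≫ h.Ψ.functor.leftUnitor.symm⟩,
    fun B' hB' => hB'.elim fun e => ⟨B'.leftUnitor.symm ≪≫ e.symm ≪≫ h.Ψ.functor.rightUnitor⟩⟩

/-- **F-2811 `CompatibleWithPerfection` at THE GENUINE PERFECTIONS, for `C₁` of perfect type** ([FrdI] Def. 3.1 (iii) /
Prop. 3.2: abc-iut-L1-d9's `PreFrobenioidData.perfection hF_i`): if `Ψ` carries arrows of Frobenius type to arrows of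
Frobenius type of the same degree (`IsFrobeniusCompatible`; a theorem under [FrdI] Thm. 3.4 (iii)'s hypotheses, cf.
`FrdI.isFrobeniusCompatible_of_thm34iii`, and for the §4 data abc-iut-L2's `Thm44Hyp.isFrobeniusCompatible`) and `C₁` is
of perfect type, then `Ψpf := Perfection.map` is an equivalence fitting a `1`-commutative, BARE-`1`-unique square with
`C_i → C_i^pf` — abc-iut-L1-d1's `Perfection.oneUniqueSquare_map_of_isOfPerfectType` BY NAME.  CONDITIONAL INSTANCE at
the genuine carrier; the perfect-type hypothesis cannot be dropped (abc-iut-L1-d4's `DegreeModel.not_oneUniqueSquare_toPf`).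
[cite: MochizukiEtTh2009, Cor 3.8 p.81] -/
theorem compatibleWithPerfection_perfection_of_isOfPerfectType (h : Cor38Hyp C₁ C₂)
    (hF₁ : PreFrobenioid.IsFrobenioid C₁.toElem) (hF₂ : PreFrobenioid.IsFrobenioid C₂.toElem)
    (hP₁ : PreFrobenioid.IsOfPerfectType C₁.toElem)
    (hΨ : PreFrobenioid.IsFrobeniusCompatible C₁.toElem C₂.toElem h.Ψ.functor) :
    Literature.AnabelianGeometry.EtaleTheta.Cor38Hyp.CompatibleWithPerfection h
      (PreFrobenioidData.perfection hF₁) (PreFrobenioidData.perfection hF₂) :=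
  ⟨PreFrobenioid.Perfection.map (hF₁ := hF₁) (hF₂ := hF₂) hΨ,
    PreFrobenioid.Perfection.oneUniqueSquare_map_of_isOfPerfectType (hF₁ := hF₁) (hF₂ := hF₂) hP₁ h.Ψ hΨ⟩

end Cor38Hyp

/-! ## At the model of record: the Tate tower -/

namespace TateTowerFrd

variable (R S R' S' : ((Discrete PUnit.{1})ᵒᵖ ⥤ CommMonCat.{0}) → Prop)
  (h : Cor38Hyp (temperedFrobenioid R S) (temperedFrobenioid R' S'))

/-- **F-2811 at the MODEL OF RECORD, for every `h : Cor38Hyp` between two Tate-tower tempered Frobenioids — NO binder beyond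
`h`** (abc-iut-w6-d048's `TateTowerFrd.temperedFrobenioid`, the `p`-adic Frobenioid of the base field of the Tate curve;
identity perfection data, «INSTANCE at toy perfection datum»). [cite: MochizukiEtTh2009, Cor 3.8 p.81] -/
theorem cor38Hyp_compatibleWithPerfection_idPerfectionData :
    Literature.AnabelianGeometry.EtaleTheta.Cor38Hyp.CompatibleWithPerfection h
      { Pf := (temperedFrobenioid R S).category
        toPf := 𝟭 _
        root := fun A _ => A
        root_one := fun _ => rfl
        root_surjective := fun X => ⟨X, 1, rfl⟩
        ops := (temperedFrobenioid R S).opsData }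
      { Pf := (temperedFrobenioid R' S').category
        toPf := 𝟭 _
        root := fun A _ => A
        root_one := fun _ => rfl
        root_surjective := fun X => ⟨X, 1, rfl⟩
        ops := (temperedFrobenioid R' S').opsData } :=
  h.compatibleWithPerfection_idPerfectionData

end TateTowerFrd

end Literature.AnabelianGeometry.EtaleTheta

end
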